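import Literature.Algebra.Module.KernelBaseChangeDescent
import Mathlib.Algebra.Homology.Embedding.CochainComplex
import Mathlib.Algebra.Category.ModuleCat.Abelian
import HarnessLib

/-!
# Cohomology and base change above the vanishing line, for a strictly perfect complex over a local ring
# (Mumford AV §5 Cor. 3; EGA III 7.7.5/7.7.10; Hartshorne III 12.11)

Layer `Literature/Algebra/Homology`; namespace `Literature.Algebra.Homology`; THEOREMS ONLY (★
`Algebra/Module/KernelBaseChangeDescent` + Mathlib; no definition, no named fact, no instance, no notation, no `sorry`).

Let `R` be a LOCAL ring with residue field `k` and `K•` a cochain complex of FINITE PROJECTIVE `R`-modules with `Kⁱ = 0` for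
`i > r` (a Grothendieck complex of a proper flat family over `Spec R`, ★ `Algebra/Homology/PerfectOfPseudoCoherent`).  Read
the differentials as linear maps `dⁱ = (K.d i (i+1)).hom` and base change as `LinearMap.baseChange B` (Mumford: `K• ⊗_A B`).

* **`exact_baseChange_of_exact_residueField`** — if the fibre complex `K• ⊗ k` is exact in every degree `i ≥ q`, then
  for EVERY `R`-algebra `B` the complex `K• ⊗ B` is exact in every degree `i ≥ q`, AND the cycles `Z^{q−1} = ker d^{q−1}` are
  a finite projective module COMMUTING WITH BASE CHANGE (`B ⊗ Z^{q−1} → B ⊗ K^{q−1}` injective with range `ker (d^{q−1} ⊗ B)`)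
  — Mumford §5 Cor. 3 «if `H^p(X_y, F_y) = 0` for all `y` then `R^{p−1}f_*F ⊗ k(y) → H^{p−1}(X_y, F_y)` is an
  isomorphism», in its local-ring form with all degrees `≥ q` (descending induction from the top degree by ★
  `kerBaseChange_step`; the top rung is `d^r = 0`, `Z^r = K^r`).
* `exact_baseChange_of_exact_residueField_of_isStrictlyLE` — the same with `[K.IsStrictlyLE r]`, the output shape of ★
  `exists_strictlyPerfect_quasiIso_of_flat`; `ker_top_baseChange` — the top rung; `exact_baseChange_of_subsingleton` —
  exactness in a zero degree.

Consumers read `H^{q−1}(K• ⊗ B) = coker (B ⊗ K^{q−2} → B ⊗ Z^{q−1}) = B ⊗ H^{q−1}(K•)` by right exactness.  Cell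
`hodgecm-mathlib` (D-0151), F-DAG (h2) (price sheet v0.1 §3 F-2 (2b); consumer EGA III 4.7.1: at `R = A_𝔭`, `q = 1`,
`K•` the Grothendieck complex of `L^n`, Serre vanishing on the fibre ⇒ `Γ(X_{A_𝔭}, L^n) ↠ Γ(X_𝔭, L_𝔭^n)`).  Count-neutral capital;
HC_CM is proved only modulo the 7 printed citations until rung 0 closes; nothing here is about HC.

## References
* [MumfordAV1970] D. Mumford, *Abelian Varieties* (1970), §5 Cor. 3 (p. 53).
* [Hartshorne1977] R. Hartshorne, *Algebraic Geometry*, III Thm. 12.11 (p. 290).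
* A. Grothendieck, EGA III₂ (1963), 7.7.5, 7.7.10.
-/

universe u

open CategoryTheory CategoryTheory.Limits TensorProduct Module
open Literature.Algebra.Module

noncomputable section

namespace Literature.Algebra.Homology

variable {R : Type u} [CommRing R] (K : CochainComplex (ModuleCat.{u} R) ℤ)

/-- Consecutive differentials compose to zero, as linear maps. [cite: MumfordAV1970, §5 Cor. 3 (p. 53)] -/
theorem hom_d_comp_hom_d (i j l : ℤ) : (K.d j l).hom ∘ₗ (K.d i j).hom = 0 := by
  rw [← ModuleCat.hom_comp, K.d_comp_d, ModuleCat.hom_zero]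

/-- In a degree `i` where `Kⁱ = 0`, the base-changed complex `K• ⊗ B` is (trivially) exact.
[cite: MumfordAV1970, §5 Cor. 3 (p. 53)] -/
theorem exact_baseChange_of_subsingleton (i : ℤ) [Subsingleton (K.X i)] (B : Type u) [CommRing B] [Algebra R B] :
    Function.Exact ((K.d (i - 1) i).hom.baseChange B) ((K.d i (i + 1)).hom.baseChange B) := by
  intro y
  constructor
  · intro _
    exact ⟨0, Subsingleton.elim _ _⟩
  · rintro ⟨x, rfl⟩
    rw [← LinearMap.comp_apply, ← LinearMap.baseChange_comp, hom_d_comp_hom_d, LinearMap.baseChange_zero,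
      LinearMap.zero_apply]

/-- **The top rung**: if `K^{m+1} = 0` then `d^m = 0`, `Z^m = K^m` is finite projective and commutes with every base change.
[cite: MumfordAV1970, §5 Cor. 3 (p. 53)] -/
theorem ker_top_baseChange (m : ℤ) [Subsingleton (K.X (m + 1))]
    (hK : Module.Finite R (K.X m) ∧ Module.Projective R (K.X m)) :
    (Module.Finite R (LinearMap.ker (K.d m (m + 1)).hom) ∧ Module.Projective R (LinearMap.ker (K.d m (m + 1)).hom)) ∧
      ∀ (B : Type u) [CommRing B] [Algebra R B],
        Function.Injective ((LinearMap.ker (K.d m (m + 1)).hom).subtype.baseChange B) ∧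
          LinearMap.range ((LinearMap.ker (K.d m (m + 1)).hom).subtype.baseChange B) =
            LinearMap.ker ((K.d m (m + 1)).hom.baseChange B) := by
  haveI := hK.1
  haveI := hK.2
  -- `d^m : K^m → 0` is onto the (projective, finite) zero module
  have hsurj : Function.Surjective (K.d m (m + 1)).hom := fun y => ⟨0, Subsingleton.elim _ _⟩
  haveI : Module.Projective R (K.X (m + 1)) := Module.Projective.of_free
  exact ker_baseChange_of_surjective (K.d m (m + 1)).hom hsurj

/-- **COHOMOLOGY AND BASE CHANGE ABOVE THE VANISHING LINE (local ring).**  `R` local with residue field `k`; `K•` a cochain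
complex of finite projective `R`-modules with `Kⁱ = 0` for `i > r`; `q` an integer such that the fibre complex is exact in
every degree `i ≥ q`: `Function.Exact (d^{i−1} ⊗ k) (dⁱ ⊗ k)`.  Then for every `R`-algebra `B`: (i) `K• ⊗ B` is exact in
every degree `i ≥ q`; (ii) `Z^{q−1} = ker d^{q−1}` is finite projective, and `B ⊗ Z^{q−1} → B ⊗ K^{q−1}` is injective with range
`ker (d^{q−1} ⊗ B)`. [cite: MumfordAV1970, §5 Cor. 3 (p. 53)] [cite: Hartshorne1977, III Thm. 12.11 (p. 290)] -/
theorem exact_baseChange_of_exact_residueField [IsLocalRing R] (r : ℤ) (htop : ∀ i, r < i → Subsingleton (K.X i))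
    (hK : ∀ n, Module.Finite R (K.X n) ∧ Module.Projective R (K.X n)) (q : ℤ)
    (hfib : ∀ i, q ≤ i → Function.Exact ((K.d (i - 1) i).hom.baseChange (IsLocalRing.ResidueField R))
      ((K.d i (i + 1)).hom.baseChange (IsLocalRing.ResidueField R))) :
    (∀ (B : Type u) [CommRing B] [Algebra R B] (i : ℤ), q ≤ i →
        Function.Exact ((K.d (i - 1) i).hom.baseChange B) ((K.d i (i + 1)).hom.baseChange B)) ∧
      (Module.Finite R (LinearMap.ker (K.d (q - 1) q).hom) ∧ Module.Projective R (LinearMap.ker (K.d (q - 1) q).hom)) ∧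
      ∀ (B : Type u) [CommRing B] [Algebra R B],
        Function.Injective ((LinearMap.ker (K.d (q - 1) q).hom).subtype.baseChange B) ∧
          LinearMap.range ((LinearMap.ker (K.d (q - 1) q).hom).subtype.baseChange B) =
            LinearMap.ker ((K.d (q - 1) q).hom.baseChange B) := by
  -- the invariant `INV m`: `Z^m` finite projective commuting with base change; it holds for `m ≥ r` (top rung) and descends
  -- through every degree `m ≥ q` by ★ `kerBaseChange_step`, carrying exactness of `K• ⊗ B` at `m` with it.
  have INV : ∀ n : ℕ, ∀ m : ℤ, m = r - n → q - 1 ≤ m →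
      ((Module.Finite R (LinearMap.ker (K.d m (m + 1)).hom) ∧ Module.Projective R (LinearMap.ker (K.d m (m + 1)).hom)) ∧
        ∀ (B : Type u) [CommRing B] [Algebra R B],
          Function.Injective ((LinearMap.ker (K.d m (m + 1)).hom).subtype.baseChange B) ∧
            LinearMap.range ((LinearMap.ker (K.d m (m + 1)).hom).subtype.baseChange B) =
              LinearMap.ker ((K.d m (m + 1)).hom.baseChange B)) ∧
      ∀ (B : Type u) [CommRing B] [Algebra R B] (i : ℤ), m < i → q ≤ i →
        Function.Exact ((K.d (i - 1) i).hom.baseChange B) ((K.d i (i + 1)).hom.baseChange B) := by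
    intro n
    induction n with
    | zero =>
      intro m hm _
      haveI : Subsingleton (K.X (m + 1)) := htop _ (by omega)
      refine ⟨ker_top_baseChange K m (hK m), fun B _ _ i hi _ => ?_⟩
      -- above the top everything is zero
      haveI : Subsingleton (K.X i) := htop _ (by omega)
      exact exact_baseChange_of_subsingleton K i B
    | succ n ih =>
      intro m hm hqm
      -- the invariant one degree up, and the step at `P := K^m`, `Q := K^{m+1}`, `W := K^{m+2}`
      obtain ⟨⟨hZ, hZbc⟩, hexact⟩ := ih (m + 1) (by omega) (by omega)
      haveI := (hK m).1
      haveI := (hK m).2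
      have hm1 : q ≤ m + 1 := by omega
      have hstep := kerBaseChange_step (K.d m (m + 1)).hom (K.d (m + 1) (m + 1 + 1)).hom (hom_d_comp_hom_d K _ _ _) hZ
        (fun B _ _ => hZbc B) (by
          have h := hfib (m + 1) hm1
          rwa [show m + 1 - 1 = m by omega] at h)
      obtain ⟨hZ', hZbc', hex'⟩ := hstep
      refine ⟨⟨hZ', fun B _ _ => hZbc' B⟩, fun B _ _ i hi hqi => ?_⟩
      by_cases him : i = m + 1
      · subst him
        rw [show m + 1 - 1 = m by omega]
        exact hex' B
      · exact hexact B i (by omega) hqi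
  -- read off at `m := q - 1` (or, if `q - 1 > r`, everything is above the top)
  have hq : q - 1 + 1 = q := by omega
  by_cases hqr : q - 1 ≤ r
  · obtain ⟨n, hn⟩ : ∃ n : ℕ, (q - 1 : ℤ) = r - n := ⟨(r - (q - 1)).toNat, by omega⟩
    obtain ⟨hinv, hexact⟩ := INV n (q - 1) hn le_rfl
    rw [hq] at hinv
    exact ⟨fun B _ _ i hqi => hexact B i (by omega) hqi, hinv.1, fun B _ _ => hinv.2 B⟩
  · -- `q - 1 > r`: every degree `≥ q - 1 + 1` is above the top, all statements are about zero modules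
    haveI : Subsingleton (K.X (q - 1 + 1)) := htop _ (by omega)
    have htop' := ker_top_baseChange K (q - 1) (hK (q - 1))
    rw [hq] at htop'
    refine ⟨fun B _ _ i hqi => ?_, htop'.1, fun B _ _ => htop'.2 B⟩
    haveI : Subsingleton (K.X i) := htop _ (by omega)
    exact exact_baseChange_of_subsingleton K i B

/-- **Cohomology and base change above the vanishing line — `IsStrictlyLE` form**, plugging onto the strictly perfect
replacement ★ `exists_strictlyPerfect_quasiIso_of_flat` (`P.IsStrictlyLE r ∧ ∀ n, Finite ∧ Projective (P.X n)`): same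
conclusion as `exact_baseChange_of_exact_residueField`. [cite: MumfordAV1970, §5 Cor. 3 (p. 53)]
[cite: Hartshorne1977, III Thm. 12.11 (p. 290)] -/
theorem exact_baseChange_of_exact_residueField_of_isStrictlyLE [IsLocalRing R] (r : ℤ) [K.IsStrictlyLE r]
    (hK : ∀ n, Module.Finite R (K.X n) ∧ Module.Projective R (K.X n)) (q : ℤ)
    (hfib : ∀ i, q ≤ i → Function.Exact ((K.d (i - 1) i).hom.baseChange (IsLocalRing.ResidueField R))
      ((K.d i (i + 1)).hom.baseChange (IsLocalRing.ResidueField R))) :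
    (∀ (B : Type u) [CommRing B] [Algebra R B] (i : ℤ), q ≤ i →
        Function.Exact ((K.d (i - 1) i).hom.baseChange B) ((K.d i (i + 1)).hom.baseChange B)) ∧
      (Module.Finite R (LinearMap.ker (K.d (q - 1) q).hom) ∧ Module.Projective R (LinearMap.ker (K.d (q - 1) q).hom)) ∧
      ∀ (B : Type u) [CommRing B] [Algebra R B],
        Function.Injective ((LinearMap.ker (K.d (q - 1) q).hom).subtype.baseChange B) ∧
          LinearMap.range ((LinearMap.ker (K.d (q - 1) q).hom).subtype.baseChange B) =
            LinearMap.ker ((K.d (q - 1) q).hom.baseChange B) :=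
  exact_baseChange_of_exact_residueField K r
    (fun i hi => ModuleCat.isZero_iff_subsingleton.mp (K.isZero_of_isStrictlyLE r i hi)) hK q hfib

end Literature.Algebra.Homology

end
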